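import Summits.Ventures.GridStability.Lyapunov.StructurePreservingBlockRows
import Summits.Ventures.GridStability.Lyapunov.StructurePreservingBlockCover
import HarnessLib

/-!
# Signed couplings IV — the potential on the closed block region: nonnegativity, tight faces force the level
# ((ii)′), boundedness and compactness of the sublevel piece on the momentum leaf ((i)′)

Venture GRIDFUSION, G2-SCALE cell; card «idea-3 (cycle 4) / signed-coupling-triangle-absorption»
(HOME/IDEAS-G2.md § l.675; crit-1 GRADE PASS · NEW-COMBINATION, STATUS 2026-08-28T20:54:27Z); the planner's scratch
proof `HOME/idea-3/c4/BlockRoaW.lean` (sha16 ce7574047d5005c1, 2 175 lines, farm rc 0 / 0 sorry / standard axioms,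
crit-1 g2 independent check STATUS l.10676) filed in content by the cell's Lean-lane seat gridfusion-sos-5 (g11), split
into tree modules `StructurePreservingBlock{Energy,Rows,Cover,Region,Roa,Level,Toys}`; namespace renamed from
`…Ideas.TriangleAbsorption.Roa` to `…Lyapunov.StructurePreserving.SignedBlock`. 0 kit, 0 facts.
THREE COLUMNS: theorems about the MODELLED lossless structure-preserving model MV-3 with SIGNED couplings (negative
branch reactances: three-winding-transformer star equivalents, series capacitors); nothing here is a certificate for
any benchmark and nothing here certifies a real grid.

WHAT THIS MODULE SAYS (`BlockRoaW.lean` §D–§E; the tree's `StructurePreservingPolytope` §§ (i)(ii) with the per-edge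
hypothesis `0 ≤ b` replaced by «free coupling `≥ 0` + a block cover»).  On the CLOSED region: every free edge term
and every block energy is `≥ 0`, so `W ≥ 0`, each single free term and each block is `≤ W`; a TIGHT free slab
(`|σᵢⱼ| = π`) costs `bfree·vtGap ≤ W`, a tight leg face (`|xᵢ| = ρ`) costs `F_k ≤ W_k ≤ W`; hence below the level
(`LevelBelowFaces c`, `V ≤ c`) the closed region IS the open region ((ii)′).  Owned pairs deviate by `≤ 2ρ ≤ π`,
free coupled pairs by `≤ 2π`, so on a preconnected coupling graph the tree's path bound + momentum pinning give a
state bound and the sublevel piece `{x ∈ region ∩ constraintSet | V x ≤ c}` is COMPACT ((i)′).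

* `freeT_nonneg`, `energy_nonneg_of_mem`, `potential_nonneg_of_mem`, `energy_le_potential`, `freeT_le_potential`;
* `lt_phaseEnergy_of_tight_free`, `face_le_energy_of_tight`, `lt_phaseEnergy_of_tight_leg`,
  `mem_region_of_phaseEnergy_le` ((ii)′);
* `abs_sub_le_pi_of_owns`, `abs_sub_le_of_sublevel`, `isCompact_sublevel` ((i)′).
-/

noncomputable section

open Set Filter Topology Real Finset
open Summit.Ventures.GridStability.Models.StructurePreserving
open Summit.Ventures.GridStability.Models.StructurePreserving.Params
open Summit.Ventures.GridStability.Lyapunov.StructurePreserving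
open Literature.MathematicalPhysics.PowerSystems.ClassicalModel.LosslessSystem (vtGap vtGap_le_of_abs_eq)
open Literature.MathematicalPhysics.PowerSystems (SinusoidalCoupling.sector_nonneg
  SinusoidalCoupling.sector_pos_of_abs_add_lt)

namespace Summit.Ventures.GridStability.Lyapunov.StructurePreserving.SignedBlock

variable {n : ℕ}

namespace BlockCover

variable {p : Params n} {δ₀ : Fin n → ℝ}

/-! ## §D. The potential on the closed region: nonnegativity, single terms, tight faces ((ii)′) -/

/-- The free edge-energy family is symmetric in the pair (symmetric `b`). [folklore] -/
theorem freeT_symm (𝒦 : BlockCover p δ₀) (hsymm : ∀ i j, p.b i j = p.b j i) (δ : Fin n → ℝ)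
    (i j : Fin n) : 𝒦.freeT δ j i = 𝒦.freeT δ i j := by
  unfold freeT
  rw [𝒦.bfree_symm hsymm i j, show δ j - δ i = -(δ i - δ j) by ring,
    show δ₀ j - δ₀ i = -(δ₀ i - δ₀ j) by ring, branchEnergy_neg_neg]

/-- Every free edge term is `≥ 0` on the closed region (tree `branchEnergy_nonneg` on the slab). [folklore] -/
theorem freeT_nonneg (𝒦 : BlockCover p δ₀)
    (h0 : ∀ i j, 𝒦.bfree i j ≠ 0 → |δ₀ i - δ₀ j| ≤ π / 2)
    {x : (Fin n → ℝ) × (Fin n → ℝ)} (hx : x ∈ 𝒦.regionLe) (i j : Fin n) :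
    0 ≤ 𝒦.freeT x.1 i j := by
  unfold freeT
  by_cases hb : 𝒦.bfree i j = 0
  · rw [hb, zero_mul]
  · exact mul_nonneg (𝒦.bfree_nonneg i j) (branchEnergy_nonneg (h0 i j hb) (hx.1 i j hb))

/-- Every block energy is `≥ 0` on the closed region ((i)′ of module II with the cover's fields). [folklore] -/
theorem energy_nonneg_of_mem (𝒦 : BlockCover p δ₀) (k : Fin 𝒦.t) {x : (Fin n → ℝ) × (Fin n → ℝ)}
    (hx : x ∈ 𝒦.regionLe) : 0 ≤ (𝒦.tri k).energy δ₀ x.1 := by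
  rw [Triangle.energy_eq_blockEnergy]
  obtain ⟨hβ₁, hβ₂⟩ := 𝒦.legs_pos k
  obtain ⟨hw₁, hw₂⟩ := 𝒦.window k
  obtain ⟨⟨e₁, e₁'⟩, ⟨e₂, e₂'⟩⟩ := 𝒦.row_m k
  obtain ⟨h₁, h₂, hrow⟩ := 𝒦.harmonic_m k
  exact blockEnergy_nonneg_of_endpointRows (𝒦.base_nonneg k) hβ₁ hβ₂ (𝒦.ρ_pos k)
    hw₁ hw₂ e₁ e₁' e₂ e₂' h₁.le h₂.le hrow.le (hx.2 k).1 (hx.2 k).2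

/-- The free part of the potential is `≥ 0` on the closed region. [folklore] -/
theorem sum_freeT_nonneg (𝒦 : BlockCover p δ₀)
    (h0 : ∀ i j, 𝒦.bfree i j ≠ 0 → |δ₀ i - δ₀ j| ≤ π / 2)
    {x : (Fin n → ℝ) × (Fin n → ℝ)} (hx : x ∈ 𝒦.regionLe) :
    0 ≤ ∑ i, ∑ j, 𝒦.freeT x.1 i j :=
  Finset.sum_nonneg fun i _ => Finset.sum_nonneg fun j _ => 𝒦.freeT_nonneg h0 hx i j

/-- The block part of the potential is `≥ 0` on the closed region. [folklore] -/
theorem sum_energy_nonneg (𝒦 : BlockCover p δ₀) {x : (Fin n → ℝ) × (Fin n → ℝ)} (hx : x ∈ 𝒦.regionLe) :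
    0 ≤ ∑ k, (𝒦.tri k).energy δ₀ x.1 :=
  Finset.sum_nonneg fun k _ => 𝒦.energy_nonneg_of_mem k hx

/-- **`W ≥ 0` on the closed region.** -/
theorem potential_nonneg_of_mem (𝒦 : BlockCover p δ₀)
    (h0 : ∀ i j, 𝒦.bfree i j ≠ 0 → |δ₀ i - δ₀ j| ≤ π / 2)
    {x : (Fin n → ℝ) × (Fin n → ℝ)} (hx : x ∈ 𝒦.regionLe) : 0 ≤ p.potential δ₀ x.1 := by
  rw [𝒦.potential_eq_free_add_blocks]
  have h1 := 𝒦.sum_freeT_nonneg h0 hx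
  have h2 := 𝒦.sum_energy_nonneg hx
  positivity

/-- **Every block is below the potential** on the closed region. -/
theorem energy_le_potential (𝒦 : BlockCover p δ₀)
    (h0 : ∀ i j, 𝒦.bfree i j ≠ 0 → |δ₀ i - δ₀ j| ≤ π / 2)
    {x : (Fin n → ℝ) × (Fin n → ℝ)} (hx : x ∈ 𝒦.regionLe) (k : Fin 𝒦.t) :
    (𝒦.tri k).energy δ₀ x.1 ≤ p.potential δ₀ x.1 := by
  rw [𝒦.potential_eq_free_add_blocks]
  have h1 := 𝒦.sum_freeT_nonneg h0 hx
  have h2 : (𝒦.tri k).energy δ₀ x.1 ≤ ∑ k', (𝒦.tri k').energy δ₀ x.1 :=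
    Finset.single_le_sum (f := fun k' => (𝒦.tri k').energy δ₀ x.1)
      (fun k' _ => 𝒦.energy_nonneg_of_mem k' hx) (Finset.mem_univ k)
  linarith

/-- **Every free edge term is below the potential** on the closed region. -/
theorem freeT_le_potential (𝒦 : BlockCover p δ₀) (hsymm : ∀ i j, p.b i j = p.b j i)
    (h0 : ∀ i j, 𝒦.bfree i j ≠ 0 → |δ₀ i - δ₀ j| ≤ π / 2)
    {x : (Fin n → ℝ) × (Fin n → ℝ)} (hx : x ∈ 𝒦.regionLe) (i j : Fin n) :
    𝒦.freeT x.1 i j ≤ p.potential δ₀ x.1 := by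
  by_cases hij : i = j
  · subst hij
    have : 𝒦.freeT x.1 i i = 0 := by
      unfold freeT; simp [branchEnergy]
    rw [this]
    exact 𝒦.potential_nonneg_of_mem h0 hx
  · rw [𝒦.potential_eq_free_add_blocks]
    set T : Fin n → Fin n → ℝ := fun a c => 𝒦.freeT x.1 a c with hT
    have hTnn : ∀ a c, 0 ≤ T a c := fun a c => 𝒦.freeT_nonneg h0 hx a c
    have hrow : ∀ a c, T a c ≤ ∑ c', T a c' := fun a c =>
      Finset.single_le_sum (f := fun c' => T a c') (fun c' _ => hTnn a c') (Finset.mem_univ c)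
    have hrows : (∑ c', T i c') + ∑ c', T j c' ≤ ∑ a, ∑ c', T a c' := by
      rw [← Finset.sum_pair (f := fun a => ∑ c', T a c') hij]
      exact Finset.sum_le_sum_of_subset_of_nonneg (Finset.subset_univ _)
        fun a _ _ => Finset.sum_nonneg fun c' _ => hTnn a c'
    have h2 : T i j + T j i ≤ ∑ a, ∑ c', T a c' := (add_le_add (hrow i j) (hrow j i)).trans hrows
    have hsym : T j i = T i j := 𝒦.freeT_symm hsymm x.1 i j
    rw [hsym] at h2
    have h3 := 𝒦.sum_energy_nonneg hx
    show T i j ≤ _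
    linarith

/-- **A tight FREE edge costs more than the level.** -/
theorem lt_phaseEnergy_of_tight_free (𝒦 : BlockCover p δ₀) (hp : p.WellFormed)
    (h0 : ∀ i j, 𝒦.bfree i j ≠ 0 → |δ₀ i - δ₀ j| ≤ π / 2) {c : ℝ} (hc : 𝒦.LevelBelowFaces c)
    {x : (Fin n → ℝ) × (Fin n → ℝ)} (hx : x ∈ 𝒦.regionLe) {i j : Fin n} (hij : 𝒦.bfree i j ≠ 0)
    (htight : |(x.1 i - x.1 j) + (δ₀ i - δ₀ j)| = π) :
    c < phaseEnergy p δ₀ x := by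
  have hgap : vtGap (δ₀ i - δ₀ j) ≤ branchEnergy (x.1 i - x.1 j) (δ₀ i - δ₀ j) := by
    have h := vtGap_le_of_abs_eq (h0 i j hij) htight
    have hid : branchEnergy (x.1 i - x.1 j) (δ₀ i - δ₀ j)
        = (Real.cos (δ₀ i - δ₀ j) + (δ₀ i - δ₀ j) * Real.sin (δ₀ i - δ₀ j))
          - (Real.cos (x.1 i - x.1 j) + (x.1 i - x.1 j) * Real.sin (δ₀ i - δ₀ j)) := by
      unfold branchEnergy; ring
    rwa [← hid] at h
  have h1 : 𝒦.bfree i j * vtGap (δ₀ i - δ₀ j) ≤ 𝒦.freeT x.1 i j := by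
    unfold freeT
    exact mul_le_mul_of_nonneg_left hgap (𝒦.bfree_nonneg i j)
  have h2 := 𝒦.freeT_le_potential hp.b_symm h0 hx i j
  have hK : 0 ≤ p.kinetic x.2 := p.kinetic_nonneg (fun k hk => (hp.M_pos k hk).le) x.2
  have hV : phaseEnergy p δ₀ x = p.kinetic x.2 + p.potential δ₀ x.1 := rfl
  rw [hV]
  linarith [hc.1 i j hij]

/-- **The face value of a block is attained on its tight faces**: `|x₁| = ρ` or `|x₂| = ρ` ⇒ `F_k ≤ W_k`. -/
theorem face_le_energy_of_tight (𝒦 : BlockCover p δ₀) (k : Fin 𝒦.t) {x : (Fin n → ℝ) × (Fin n → ℝ)}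
    (hx : x ∈ 𝒦.regionLe)
    (htight : |(𝒦.tri k).x₁ δ₀ x.1| = (𝒦.tri k).ρ ∨ |(𝒦.tri k).x₂ δ₀ x.1| = (𝒦.tri k).ρ) :
    (𝒦.tri k).face (𝒦.tri k).γ ≤ (𝒦.tri k).energy δ₀ x.1 := by
  rw [Triangle.energy_eq_blockEnergy]
  obtain ⟨hβ₁, hβ₂⟩ := 𝒦.legs_pos k
  obtain ⟨hw₁, hw₂⟩ := 𝒦.window k
  obtain ⟨⟨e₁, e₁'⟩, ⟨e₂, e₂'⟩⟩ := 𝒦.row_m k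
  obtain ⟨h₁, h₂, _⟩ := 𝒦.harmonic_m k
  have hγ : 0 ≤ (𝒦.tri k).γ := 𝒦.base_nonneg k
  have hρ := 𝒦.ρ_pos k
  rcases htight with h | h
  · have hF := blockEnergy_face_of_endpointRows (a₃ := δ₀ (𝒦.tri k).leg₁ - δ₀ (𝒦.tri k).leg₂)
      hγ hβ₁ hβ₂ hρ hw₁ hw₂ e₁ e₁' e₂ e₂' h₂ (hx.2 k).2
    rcases (abs_eq hρ.le).1 h with h' | h' <;> rw [h']
    · exact (min_le_left _ _).trans hF.1
    · exact (min_le_left _ _).trans hF.2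
  · have hF := blockEnergy_face₂_of_endpointRows (a₃ := δ₀ (𝒦.tri k).leg₁ - δ₀ (𝒦.tri k).leg₂)
      hγ hβ₁ hβ₂ hρ hw₁ hw₂ e₁ e₁' e₂ e₂' h₁ (hx.2 k).1
    rcases (abs_eq hρ.le).1 h with h' | h' <;> rw [h']
    · exact (min_le_right _ _).trans hF.1
    · exact (min_le_right _ _).trans hF.2

/-- **A tight box face costs more than the level.** -/
theorem lt_phaseEnergy_of_tight_leg (𝒦 : BlockCover p δ₀) (hp : p.WellFormed)
    (h0 : ∀ i j, 𝒦.bfree i j ≠ 0 → |δ₀ i - δ₀ j| ≤ π / 2) {c : ℝ} (hc : 𝒦.LevelBelowFaces c)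
    {x : (Fin n → ℝ) × (Fin n → ℝ)} (hx : x ∈ 𝒦.regionLe) (k : Fin 𝒦.t)
    (htight : |(𝒦.tri k).x₁ δ₀ x.1| = (𝒦.tri k).ρ ∨ |(𝒦.tri k).x₂ δ₀ x.1| = (𝒦.tri k).ρ) :
    c < phaseEnergy p δ₀ x := by
  have h1 := 𝒦.face_le_energy_of_tight k hx htight
  have h2 := 𝒦.energy_le_potential h0 hx k
  have hK : 0 ≤ p.kinetic x.2 := p.kinetic_nonneg (fun k hk => (hp.M_pos k hk).le) x.2
  have hV : phaseEnergy p δ₀ x = p.kinetic x.2 + p.potential δ₀ x.1 := rfl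
  rw [hV]
  linarith [hc.2 k]

/-- **Below the level, `V ≤ c` on the closed region forces the OPEN region** ((ii)′). -/
theorem mem_region_of_phaseEnergy_le (𝒦 : BlockCover p δ₀) (hp : p.WellFormed)
    (h0 : ∀ i j, 𝒦.bfree i j ≠ 0 → |δ₀ i - δ₀ j| ≤ π / 2) {c : ℝ} (hc : 𝒦.LevelBelowFaces c)
    {x : (Fin n → ℝ) × (Fin n → ℝ)} (hx : x ∈ 𝒦.regionLe) (hV : phaseEnergy p δ₀ x ≤ c) :
    x ∈ 𝒦.region := by
  refine ⟨fun i j hij => ?_, fun k => ⟨?_, ?_⟩⟩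
  · rcases (hx.1 i j hij).lt_or_eq with h | h
    · exact h
    · exact absurd hV (not_le.2 (𝒦.lt_phaseEnergy_of_tight_free hp h0 hc hx hij h))
  · rcases (hx.2 k).1.lt_or_eq with h | h
    · exact h
    · exact absurd hV (not_le.2 (𝒦.lt_phaseEnergy_of_tight_leg hp h0 hc hx k (Or.inl h)))
  · rcases (hx.2 k).2.lt_or_eq with h | h
    · exact h
    · exact absurd hV (not_le.2 (𝒦.lt_phaseEnergy_of_tight_leg hp h0 hc hx k (Or.inr h)))


/-! ## §E. Boundedness and compactness of the sublevel piece on the momentum leaf ((i)′) -/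

/-- An owned pair's angle deviation is at most `π` on the closed region (legs `≤ ρ ≤ π/2`, base `≤ 2ρ`). -/
theorem abs_sub_le_pi_of_owns (𝒦 : BlockCover p δ₀) {x : (Fin n → ℝ) × (Fin n → ℝ)}
    (hx : x ∈ 𝒦.regionLe) (k : Fin 𝒦.t) {u v : Fin n} (h : (𝒦.tri k).Owns u v) :
    |(x.1 u - δ₀ u) - (x.1 v - δ₀ v)| ≤ π := by
  obtain ⟨hw₁, _⟩ := 𝒦.window k
  have hρ : (𝒦.tri k).ρ ≤ π / 2 := by linarith [abs_nonneg (δ₀ (𝒦.tri k).leg₁ - δ₀ (𝒦.tri k).apex)]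
  have b1 := (hx.2 k).1
  have b2 := (hx.2 k).2
  simp only [Triangle.x₁, Triangle.x₂] at b1 b2
  have hπ := Real.pi_pos
  rcases h with h | h | h <;> rw [Sym2.eq_iff] at h <;> rcases h with ⟨rfl, rfl⟩ | ⟨rfl, rfl⟩
  · rw [show x.1 (𝒦.tri k).leg₁ - δ₀ (𝒦.tri k).leg₁ - (x.1 (𝒦.tri k).apex - δ₀ (𝒦.tri k).apex)
        = x.1 (𝒦.tri k).leg₁ - x.1 (𝒦.tri k).apex - (δ₀ (𝒦.tri k).leg₁ - δ₀ (𝒦.tri k).apex) by ring]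
    linarith
  · rw [show x.1 (𝒦.tri k).apex - δ₀ (𝒦.tri k).apex - (x.1 (𝒦.tri k).leg₁ - δ₀ (𝒦.tri k).leg₁)
        = -(x.1 (𝒦.tri k).leg₁ - x.1 (𝒦.tri k).apex - (δ₀ (𝒦.tri k).leg₁ - δ₀ (𝒦.tri k).apex)) by ring,
      abs_neg]
    linarith
  · rw [show x.1 (𝒦.tri k).leg₂ - δ₀ (𝒦.tri k).leg₂ - (x.1 (𝒦.tri k).apex - δ₀ (𝒦.tri k).apex)
        = x.1 (𝒦.tri k).leg₂ - x.1 (𝒦.tri k).apex - (δ₀ (𝒦.tri k).leg₂ - δ₀ (𝒦.tri k).apex) by ring]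
    linarith
  · rw [show x.1 (𝒦.tri k).apex - δ₀ (𝒦.tri k).apex - (x.1 (𝒦.tri k).leg₂ - δ₀ (𝒦.tri k).leg₂)
        = -(x.1 (𝒦.tri k).leg₂ - x.1 (𝒦.tri k).apex - (δ₀ (𝒦.tri k).leg₂ - δ₀ (𝒦.tri k).apex)) by ring,
      abs_neg]
    linarith
  · rw [show x.1 (𝒦.tri k).leg₁ - δ₀ (𝒦.tri k).leg₁ - (x.1 (𝒦.tri k).leg₂ - δ₀ (𝒦.tri k).leg₂)
        = (x.1 (𝒦.tri k).leg₁ - x.1 (𝒦.tri k).apex - (δ₀ (𝒦.tri k).leg₁ - δ₀ (𝒦.tri k).apex))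
          - (x.1 (𝒦.tri k).leg₂ - x.1 (𝒦.tri k).apex - (δ₀ (𝒦.tri k).leg₂ - δ₀ (𝒦.tri k).apex)) by ring]
    refine (abs_sub _ _).trans ?_
    linarith
  · rw [show x.1 (𝒦.tri k).leg₂ - δ₀ (𝒦.tri k).leg₂ - (x.1 (𝒦.tri k).leg₁ - δ₀ (𝒦.tri k).leg₁)
        = (x.1 (𝒦.tri k).leg₂ - x.1 (𝒦.tri k).apex - (δ₀ (𝒦.tri k).leg₂ - δ₀ (𝒦.tri k).apex))
          - (x.1 (𝒦.tri k).leg₁ - x.1 (𝒦.tri k).apex - (δ₀ (𝒦.tri k).leg₁ - δ₀ (𝒦.tri k).apex)) by ring]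
    refine (abs_sub _ _).trans ?_
    linarith

/-- **State bound on the closed region and the momentum leaf** (tree `abs_sub_le_of_sublevel`, with the
per-edge deviation bound supplied by the slabs on pairs with free coupling and by the boxes on owned pairs). -/
theorem abs_sub_le_of_sublevel (𝒦 : BlockCover p δ₀) (hp : p.WellFormed) (hn : n ≠ 0)
    (hconn : p.couplingGraph.Preconnected)
    (h0 : ∀ i j, 𝒦.bfree i j ≠ 0 → |δ₀ i - δ₀ j| ≤ π / 2)
    {x : (Fin n → ℝ) × (Fin n → ℝ)} (hx : x ∈ 𝒦.regionLe) {c : ℝ}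
    (hV : phaseEnergy p δ₀ x ≤ c) (hL : p.momentum x.1 x.2 = p.momentum δ₀ 0) :
    (∀ i ∈ p.gen, |x.2 i| ≤ Real.sqrt (2 * c / p.M i)) ∧
    ∀ i, |x.1 i - δ₀ i| ≤ (∑ j ∈ p.gen, p.M j * Real.sqrt (2 * c / p.M j)) / (∑ j, p.D j)
        + 2 * π * n := by
  have hW0 : 0 ≤ p.potential δ₀ x.1 := 𝒦.potential_nonneg_of_mem h0 hx
  have hKc : p.kinetic x.2 ≤ c := by
    have : phaseEnergy p δ₀ x = p.kinetic x.2 + p.potential δ₀ x.1 := rfl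
    linarith
  have hω : ∀ i ∈ p.gen, |x.2 i| ≤ Real.sqrt (2 * c / p.M i) := by
    intro i hi
    have hMi := hp.M_pos i hi
    have h1 := p.half_M_mul_sq_le_kinetic (fun j hj => (hp.M_pos j hj).le) x.2 hi
    refine Real.abs_le_sqrt ?_
    rw [le_div_iff₀ hMi]
    nlinarith
  refine ⟨hω, fun i => ?_⟩
  set φ : Fin n → ℝ := fun k => x.1 k - δ₀ k with hφ
  have hedge : ∀ u v, p.couplingGraph.Adj u v → |φ u - φ v| ≤ 2 * π := by
    intro u v huv
    have hbuv : p.b u v ≠ 0 := ((p.couplingGraph_adj_of_symm hp.b_symm u v).1 huv).2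
    by_cases hf : 𝒦.bfree u v = 0
    · obtain ⟨k, hk⟩ := 𝒦.exists_owns_of_bfree_eq_zero hbuv hf
      have := 𝒦.abs_sub_le_pi_of_owns hx k hk
      simp only [hφ]
      linarith [Real.pi_pos]
    · have h1 := abs_le.1 (hx.1 u v hf)
      have h2 := abs_le.1 (h0 u v hf)
      have hid : φ u - φ v = ((x.1 u - x.1 v) + (δ₀ u - δ₀ v)) - 2 * (δ₀ u - δ₀ v) := by
        simp only [hφ]; ring
      rw [hid, abs_le]
      constructor <;> linarith [h1.1, h1.2, h2.1, h2.2]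
  have h2π : 0 ≤ 2 * π := by linarith [Real.pi_pos]
  have hpair : ∀ j, |φ i - φ j| ≤ n * (2 * π) := fun j => p.abs_sub_le_card_mul hconn h2π hedge i j
  have hDsum := sum_D_pos hp hn
  have hmom : ∑ j, p.D j * φ j = -∑ j ∈ p.gen, p.M j * x.2 j := by
    have : p.momentum x.1 x.2 - p.momentum δ₀ 0 = 0 := sub_eq_zero.mpr hL
    unfold Params.momentum at this
    simp only [Pi.zero_apply, mul_zero, Finset.sum_const_zero, zero_add] at this
    have hsplit : ∑ j, p.D j * x.1 j - ∑ j, p.D j * δ₀ j = ∑ j, p.D j * φ j := by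
      rw [← Finset.sum_sub_distrib]
      exact Finset.sum_congr rfl fun j _ => by simp only [hφ]; ring
    linarith
  have hmeanbd : |∑ j, p.D j * φ j| ≤ ∑ j ∈ p.gen, p.M j * Real.sqrt (2 * c / p.M j) := by
    rw [hmom, abs_neg]
    refine (Finset.abs_sum_le_sum_abs _ _).trans (Finset.sum_le_sum fun j hj => ?_)
    rw [abs_mul, abs_of_pos (hp.M_pos j hj)]
    exact mul_le_mul_of_nonneg_left (hω j hj) (hp.M_pos j hj).le
  have hdecomp : (∑ j, p.D j) * φ i = ∑ j, p.D j * φ j + ∑ j, p.D j * (φ i - φ j) := by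
    rw [Finset.sum_mul, ← Finset.sum_add_distrib]
    exact Finset.sum_congr rfl fun j _ => by ring
  have hdev : |∑ j, p.D j * (φ i - φ j)| ≤ (∑ j, p.D j) * (n * (2 * π)) := by
    refine (Finset.abs_sum_le_sum_abs _ _).trans ?_
    rw [Finset.sum_mul]
    refine Finset.sum_le_sum fun j _ => ?_
    rw [abs_mul, abs_of_pos (hp.D_pos j)]
    exact mul_le_mul_of_nonneg_left (hpair j) (hp.D_pos j).le
  have habs : (∑ j, p.D j) * |φ i|
      ≤ ∑ j ∈ p.gen, p.M j * Real.sqrt (2 * c / p.M j) + (∑ j, p.D j) * (n * (2 * π)) := by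
    rw [← abs_of_pos hDsum, ← abs_mul, abs_of_pos hDsum, hdecomp]
    exact (abs_add_le _ _).trans (add_le_add hmeanbd hdev)
  have : |φ i| ≤ (∑ j ∈ p.gen, p.M j * Real.sqrt (2 * c / p.M j)) / (∑ j, p.D j)
      + 2 * π * n := by
    rw [div_add' _ _ _ hDsum.ne', le_div_iff₀ hDsum]
    nlinarith
  simpa only [hφ] using this

/-- **Compactness of the sublevel piece `{x ∈ region ∩ constraintSet | V x ≤ c}`** ((i)′). -/
theorem isCompact_sublevel (𝒦 : BlockCover p δ₀) (hp : p.WellFormed) (hn : n ≠ 0)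
    (hconn : p.couplingGraph.Preconnected)
    (h0 : ∀ i j, 𝒦.bfree i j ≠ 0 → |δ₀ i - δ₀ j| ≤ π / 2) {c : ℝ}
    (hc : 𝒦.LevelBelowFaces c) :
    IsCompact {x | x ∈ 𝒦.region ∩ constraintSet p δ₀ ∧ phaseEnergy p δ₀ x ≤ c} := by
  set S' : Set ((Fin n → ℝ) × (Fin n → ℝ)) :=
    {x | x ∈ 𝒦.regionLe ∧ x ∈ constraintSet p δ₀ ∧ phaseEnergy p δ₀ x ≤ c} with hS'
  have hSS' : {x | x ∈ 𝒦.region ∩ constraintSet p δ₀ ∧ phaseEnergy p δ₀ x ≤ c} = S' := by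
    ext x
    simp only [hS', mem_setOf_eq, mem_inter_iff]
    constructor
    · rintro ⟨⟨hw, hM⟩, hV⟩
      exact ⟨𝒦.region_subset_regionLe hw, hM, hV⟩
    · rintro ⟨hw, hM, hV⟩
      exact ⟨⟨𝒦.mem_region_of_phaseEnergy_le hp h0 hc hw hV, hM⟩, hV⟩
  rw [hSS']
  refine Metric.isCompact_of_isClosed_isBounded ?_ ?_
  · have h3 : IsClosed {x : (Fin n → ℝ) × (Fin n → ℝ) | phaseEnergy p δ₀ x ≤ c} :=
      isClosed_le (contDiff_phaseEnergy p δ₀).continuous continuous_const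
    have h := 𝒦.isClosed_regionLe.inter ((isClosed_constraintSet p δ₀).inter h3)
    simpa only [hS', setOf_and, setOf_mem_eq] using h
  · rw [isBounded_iff_forall_norm_le]
    set R : ℝ := (∑ j ∈ p.gen, p.M j * Real.sqrt (2 * c / p.M j)) / (∑ j, p.D j)
      + 2 * π * n with hR
    set B : ℝ := ∑ j ∈ p.gen, Real.sqrt (2 * c / p.M j) with hB
    refine ⟨R + ‖δ₀‖ + B, fun x hx => ?_⟩
    obtain ⟨hw, ⟨hL, hω0⟩, hV⟩ := hx
    have hst := 𝒦.abs_sub_le_of_sublevel hp hn hconn h0 hw hV hL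
    have hBnn : 0 ≤ B := Finset.sum_nonneg fun j _ => Real.sqrt_nonneg _
    have hδ : ∀ i, |x.1 i| ≤ R + ‖δ₀‖ := fun i => by
      have h1 : |x.1 i - δ₀ i| ≤ R := by simpa only [hR] using hst.2 i
      have h2 : |δ₀ i| ≤ ‖δ₀‖ := by
        have := norm_le_pi_norm δ₀ i
        simpa only [Real.norm_eq_abs] using this
      calc |x.1 i| = |(x.1 i - δ₀ i) + δ₀ i| := by ring_nf
        _ ≤ |x.1 i - δ₀ i| + |δ₀ i| := abs_add_le _ _
        _ ≤ R + ‖δ₀‖ := add_le_add h1 h2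
    have hRnn : 0 ≤ R + ‖δ₀‖ := by
      obtain ⟨k, hk⟩ := Nat.exists_eq_succ_of_ne_zero hn
      subst hk
      exact (abs_nonneg _).trans (hδ 0)
    have hω : ∀ i, |x.2 i| ≤ B := fun i => by
      by_cases hi : i ∈ p.gen
      · exact (hst.1 i hi).trans (Finset.single_le_sum (f := fun j => Real.sqrt (2 * c / p.M j))
          (fun j _ => Real.sqrt_nonneg _) hi)
      · rw [hω0 i hi, abs_zero]
        exact hBnn
    have hn1 : ‖x.1‖ ≤ R + ‖δ₀‖ + B := by
      refine (pi_norm_le_iff_of_nonneg (add_nonneg hRnn hBnn)).2 fun i => ?_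
      rw [Real.norm_eq_abs]
      exact (hδ i).trans (le_add_of_nonneg_right hBnn)
    have hn2 : ‖x.2‖ ≤ R + ‖δ₀‖ + B := by
      refine (pi_norm_le_iff_of_nonneg (add_nonneg hRnn hBnn)).2 fun i => ?_
      rw [Real.norm_eq_abs]
      exact (hω i).trans (le_add_of_nonneg_left hRnn)
    rw [Prod.norm_def]
    exact max_le hn1 hn2

end BlockCover

end Summit.Ventures.GridStability.Lyapunov.StructurePreserving.SignedBlock

end
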